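/-
Copyright: the b2b-balaban T⁴-continuum CRUX team, row NE7b leaf lineage `t4-ne7b-formalise-leaf-05` (gen 157). Project licence.
-/
import Literature.MathematicalPhysics.QuantumFieldTheory.Balaban1983to89.UnitaryModel
import Literature.MathematicalPhysics.QuantumFieldTheory.Federbush1986.PureAveragesUNGauss

/-!
# HILBERT–SCHMIDT CURRENCY LETTERS ON `M_n(ℂ)`: `‖AX‖_HS ≤ ‖A‖_op‖X‖_HS`, `‖XA‖_HS ≤ ‖X‖_HS‖A‖_op`, `‖gXg* − X‖_HS ≤ 2·dist1(g)·‖X‖_HS` for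
# unitary `g`, `‖A‖_op ≤ ‖A‖_HS`, `‖A‖²_HS ≤ |n|·‖A‖²_op` — the mixed-norm letters that carry the row's E-side (operator-norm) displays and Lemma 5.5's
# (ℓ1) into print's Hilbert–Schmidt currency of the quadratic forms (row NE7b, node U5c; residual (R2′) family (2), letter (ℓ1); kernel lemmas)

Cell `pub-balaban`, sub-cell `t4`, spine estimate NE7b (`T4WeightBudget.RelWeightBound`; the cell's OWN estimate — NOT PRINTED in [Bałaban 1983–89],
NOT PROVED).  Crux-route work under `Spine/NE7b/`; NOTHING of Bałaban's is asserted; no `def`; zero `sorry`; no `T4Continuum/Support` leaf (FREEZE (0)).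
Imports (hub oleans present): `Literature.….Balaban1983to89.UnitaryModel` (`opDist1 g = ‖g − 1‖_op`, the operator norm (19) of the cell's `U(n)` model) and
`Literature.….Federbush1986.PureAveragesUNGauss` (namespace `UNGauss`: `frob_norm_sq`, `frob_norm_sq_eq_re_trace`, `frob_norm_unitary_mul`, `frob_norm_mul_unitary`,
`star_mem_unitaryGroup'` — the Frobenius = Hilbert–Schmidt norm of [B7] (17) on `M_n(ℂ)` and its unitary invariance, REUSED BY NAME, not restated).
PRIOR ART OF WEIGHT (chair X-HSCL leaf-04 g159, δ-X-HSCL-1): §1 and §3 are [B7] (20) p. 21 — the printed list «`|tr X| ≤ |X|, ‖X‖ ≤ |X|, |X| ≤ √N‖X‖,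
|XY| ≤ |X||Y|, ‖XY‖ ≤ ‖X‖‖Y‖`» (`|·|` operator, `‖·‖` NORMALISED Hilbert–Schmidt) — whose KERNEL HOME in the tree is `Literature.….Balaban1983to89.MatrixNorms`
(unit b2b-balaban-f1; `nhsNorm` currency, `N·nhsNormSq X = Σ_ij|X_ij|²`, its `‖X‖` = the L2-operator norm = `‖toEuclideanCLM X‖` by `MatrixNorms.opNorm_eq`;
the [cite] tags live there): `opNorm_le_frobenius_norm` ≡ `MatrixNorms.opNorm_sq_le_sum_norm_sq`, `frobenius_norm_sq_le_card_mul_opNorm_sq` ≡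
`MatrixNorms.nhsNormSq_le_opNorm_sq`·N (column letter `sum_norm_sq_col_le_opNorm_sq`), `frobenius_norm_mul_le_opNorm_mul` ≡ `MatrixNorms.nhsNorm_mul_le_opNorm_mul_nhsNorm`·√N
(column letter `sum_norm_sq_mul_col_le`), `frobenius_norm_mul_le_mul_opNorm` ≡ `MatrixNorms.nhsNorm_mul_le_nhsNorm_mul_opNorm`; MatrixNorms' FINDING (a) — the printed
`‖XY‖ ≤ ‖X‖‖Y‖` is FALSE for the normalised norm (`nhsNorm_mul_not_submultiplicative`) — is why §1 states the MIXED form.  THIS FILE restates those four letters in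
Mathlib's Frobenius INSTANCE `‖·‖_F = √N·nhsNorm` (the currency of `UNGauss` and of AFSI's `N = Σ‖·‖²`; the gate's dedup is silent: different currency and
spelling), and adds §2, which has no twin there.  The operator norm of a general
matrix is written `‖Matrix.toEuclideanCLM A‖` (Mathlib: `= ‖A‖` in the scope `Matrix.Norms.L2Operator`, `l2_opNorm_toEuclideanCLM`), so that both norms
appear in one statement without an instance clash; `‖·‖` on matrices below is the Frobenius norm (scope `Matrix.Norms.Frobenius`).

WHY.  The row's E-side chain at `k = 1` (leaf-02's `…OneStepCurlFormDisplay`, `…CoarseCurlTransportLetters` (CCTL)) lives in [B7]'s abstract normed algebra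
`𝔸`, which for `U(n)` is `M_n(ℂ)` with the OPERATOR norm (`U1`, `NormOneClass`); print's quadratic forms ((h2), `B9SectEKernel.gamma0_assembly`'s `⬝ᵥ`,
this lineage's `…AdmissibleFloorIMS`) are in the HILBERT–SCHMIDT currency ([B7] (17) p. 21).  Answer A-leaf05-g157-1 (journal) names the two junction
devices; `…AdmissibleFloorSeminormIMS` (this gen) is device (b); THIS FILE is device (a): the four letters that move a norm statement between the two
currencies — CCTL's (ℓ1) step `‖R(w)Z − Z‖ ≤ 2‖w − 1‖‖Z‖` with `Z` measured in HS and `w` in the operator norm (§2), and the comparison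
`‖A‖_op ≤ ‖A‖_HS ≤ √|n|·‖A‖_op` (§3) by which an operator-currency (h1) display implies the HS one at the price `|n|`.

WHAT IS PROVED ([folklore]; `n` a finite index type, matrices over `ℂ`):
* §1 ([B7] (20) p. 21 in the Frobenius instance; kernel home `MatrixNorms`) **`frobenius_norm_mul_le_opNorm_mul`** (`‖AX‖_HS ≤ ‖A‖_op‖X‖_HS`, column by
  column; `UNGauss.frob_norm_sq` BY NAME), **`frobenius_norm_mul_le_mul_opNorm`** (`‖XA‖_HS ≤ ‖X‖_HS·‖A‖_op`, by `ᴴ` and Mathlib's `Matrix.l2_opNorm_conjTranspose`).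
* §2 `opNorm_sub_one_eq_opDist1` (`‖g − 1‖_op = dist1 g`, `rfl`), **`frobenius_norm_conj_sub_le`** (`‖gXg* − X‖_HS ≤ 2·dist1(g)·‖X‖_HS` for unitary `g`;
  `UNGauss.frob_norm_mul_unitary` BY NAME — the HS twin of `…LinearisedLatticeStokesUnitary.norm_conj_sub_self_le_unitary` and of [B7]'s `norm_conjR_sub_self_le`).
* §3 ([B7] (20) p. 21 in the Frobenius instance; kernel home `MatrixNorms`) **`opNorm_le_frobenius_norm`** (`‖A‖_op ≤ ‖A‖_HS`, Cauchy–Schwarz row by row),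
  **`frobenius_norm_sq_le_card_mul_opNorm_sq`** (`‖A‖²_HS ≤ |n|·‖A‖²_op`, column by column on the basis vectors).
* §4 toy: `n = Fin 1` — both comparisons are equalities-compatible (`example`: `‖A‖²_HS ≤ 1·‖A‖²_op` and `‖A‖_op ≤ ‖A‖_HS`).

NOT HERE (honest): the k = 1 (h2) instance itself; which currency the row adopts (OWNER ∕ NC-NE7b-α UNRULED); anything of Bałaban's.  BY-NAME EFFECT ON THE
WALL: NONE.  NE7b NOT PRINTED ∕ NOT PROVED; spine PROVED 0∕9; rung (B)+1 on ONE finite T⁴ — NOT infinite volume, NOT the mass gap, NOT Clay.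
HONEST DEPENDENCY: continuum YM on T⁴ ⇐ BetaPertH ∧ nine spine estimates (0/9 proved); BetaPertH ⇐ (D1) ∧ (D4) ∧ CAP+tail; G-an2-4 gates asym, D1 and NE2/3/4.
-/

set_option autoImplicit false

noncomputable section

open Matrix WithLp
open scoped Matrix.Norms.Frobenius
open Literature.MathematicalPhysics.QuantumFieldTheory.Balaban1983to89.UnitaryModel (opDist1)
open Literature.MathematicalPhysics.QuantumFieldTheory.Federbush1986.UNGauss (frob_norm_sq frob_norm_mul_unitary star_mem_unitaryGroup')

namespace Summit.QuantumFields.BalabanUV.T4Continuum.NE7b.HilbertSchmidtCurrencyLetters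

variable {n : Type*} [Fintype n] [DecidableEq n]

/-! ## §1 Multiplication costs the operator norm of the other factor ([B7] (20) p. 21, 5th inequality in its correct mixed form; kernel home `MatrixNorms`) -/

section Mul

/-- **`‖AX‖_HS ≤ ‖A‖_op·‖X‖_HS`** — column by column, `‖A v‖₂ ≤ ‖A‖_op‖v‖₂` ([B7] (20) p. 21; = `MatrixNorms.nhsNorm_mul_le_opNorm_mul_nhsNorm`·√N, here in the
Frobenius instance). [folklore] -/
theorem frobenius_norm_mul_le_opNorm_mul (A X : Matrix n n ℂ) :
    ‖A * X‖ ≤ ‖Matrix.toEuclideanCLM (n := n) (𝕜 := ℂ) A‖ * ‖X‖ := by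
  set T := Matrix.toEuclideanCLM (n := n) (𝕜 := ℂ) A with hT
  -- one column
  have hcol : ∀ j, ∑ i, ‖(A * X) i j‖ ^ 2 ≤ ‖T‖ ^ 2 * ∑ i, ‖X i j‖ ^ 2 := by
    intro j
    have e1 : ∑ i, ‖(A * X) i j‖ ^ 2 = ‖T (toLp 2 fun k => X k j)‖ ^ 2 := by
      rw [EuclideanSpace.norm_sq_eq]
      refine Finset.sum_congr rfl fun i _ => ?_
      rw [hT, Matrix.toEuclideanCLM_toLp, PiLp.toLp_apply]
      rfl
    have e2 : ∑ i, ‖X i j‖ ^ 2 = ‖(toLp 2 fun k => X k j : EuclideanSpace ℂ n)‖ ^ 2 := by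
      rw [EuclideanSpace.norm_sq_eq]
    rw [e1, e2, ← mul_pow]
    exact pow_le_pow_left₀ (norm_nonneg _) (T.le_opNorm _) 2
  have hsq : ‖A * X‖ ^ 2 ≤ (‖T‖ * ‖X‖) ^ 2 :=
    calc ‖A * X‖ ^ 2 = ∑ j, ∑ i, ‖(A * X) i j‖ ^ 2 := by rw [frob_norm_sq, Finset.sum_comm]
      _ ≤ ∑ j, ‖T‖ ^ 2 * ∑ i, ‖X i j‖ ^ 2 := Finset.sum_le_sum fun j _ => hcol j
      _ = ‖T‖ ^ 2 * ∑ i, ∑ j, ‖X i j‖ ^ 2 := by rw [← Finset.mul_sum, Finset.sum_comm]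
      _ = (‖T‖ * ‖X‖) ^ 2 := by rw [mul_pow, frob_norm_sq]
  exact le_of_pow_le_pow_left₀ two_ne_zero (by positivity) hsq

/-- `‖Aᴴ‖_op = ‖A‖_op`, read through `toEuclideanCLM` (Mathlib's `Matrix.l2_opNorm_conjTranspose` + `l2_opNorm_toEuclideanCLM`). [folklore] -/
theorem opNorm_toEuclideanCLM_conjTranspose (A : Matrix n n ℂ) :
    ‖Matrix.toEuclideanCLM (n := n) (𝕜 := ℂ) Aᴴ‖ = ‖Matrix.toEuclideanCLM (n := n) (𝕜 := ℂ) A‖ := by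
  rw [Matrix.l2_opNorm_toEuclideanCLM, Matrix.l2_opNorm_toEuclideanCLM]
  exact Matrix.l2_opNorm_conjTranspose A

/-- **`‖XA‖_HS ≤ ‖X‖_HS·‖A‖_op`** (`(XA)ᴴ = AᴴXᴴ`, the Hilbert–Schmidt norm is `ᴴ`-invariant, and `‖Aᴴ‖_op = ‖A‖_op`; [B7] (20) p. 21; = `MatrixNorms.nhsNorm_mul_le_nhsNorm_mul_opNorm`
in the Frobenius instance). [folklore] -/
theorem frobenius_norm_mul_le_mul_opNorm (X A : Matrix n n ℂ) :
    ‖X * A‖ ≤ ‖X‖ * ‖Matrix.toEuclideanCLM (n := n) (𝕜 := ℂ) A‖ := by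
  have h := frobenius_norm_mul_le_opNorm_mul Aᴴ Xᴴ
  rw [← Matrix.conjTranspose_mul, Matrix.frobenius_norm_conjTranspose, Matrix.frobenius_norm_conjTranspose,
    opNorm_toEuclideanCLM_conjTranspose] at h
  linarith

end Mul

/-! ## §2 Unitary letter: the conjugation defect `2·dist1(g)` in mixed currency -/

section Unitary

/-- The operator-norm distance of `UnitaryModel` read through `toEuclideanCLM`: `‖g − 1‖_op = dist1 g`. [folklore] -/
theorem opNorm_sub_one_eq_opDist1 (g : Matrix n n ℂ) :
    ‖Matrix.toEuclideanCLM (n := n) (𝕜 := ℂ) (g - 1)‖ = opDist1 g := rfl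

/-- **THE CONJUGATION DEFECT IN MIXED CURRENCY**: `‖gXg* − X‖_HS ≤ 2·dist1(g)·‖X‖_HS` for unitary `g`
(`gXg* − X = (g − 1)(Xg*) + X(g* − 1)`; §1 with `‖Xg*‖_HS = ‖X‖_HS` (`UNGauss.frob_norm_mul_unitary`), and `‖X(g* − 1)‖_HS = ‖(g − 1)Xᴴ‖_HS ≤ dist1(g)‖X‖_HS`) — the step of Lemma 5.5's
(ℓ1) (`|R(w)Z − Z| ≤ 2|w − 1||Z|`) with `Z` in print's Hilbert–Schmidt norm and `w` in the operator norm. [folklore] -/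
theorem frobenius_norm_conj_sub_le {g : Matrix n n ℂ} (hg : g ∈ Matrix.unitaryGroup n ℂ) (X : Matrix n n ℂ) :
    ‖g * X * star g - X‖ ≤ 2 * opDist1 g * ‖X‖ := by
  have hsplit : g * X * star g - X = (g - 1) * (X * star g) + X * (star g - 1) := by noncomm_ring
  -- first term: left multiplication by `g − 1`
  have h1 : ‖(g - 1) * (X * star g)‖ ≤ opDist1 g * ‖X‖ := by
    have h := frobenius_norm_mul_le_opNorm_mul (g - 1) (X * star g)
    rwa [frob_norm_mul_unitary (star_mem_unitaryGroup' hg), opNorm_sub_one_eq_opDist1] at h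
  -- second term: by `ᴴ`, `(X(g* − 1))ᴴ = (g − 1)Xᴴ`
  have h2 : ‖X * (star g - 1)‖ ≤ opDist1 g * ‖X‖ := by
    have h := frobenius_norm_mul_le_opNorm_mul (g - 1) Xᴴ
    have e : (g - 1) * Xᴴ = (X * (star g - 1))ᴴ := by
      rw [Matrix.conjTranspose_mul, Matrix.conjTranspose_sub, Matrix.star_eq_conjTranspose,
        Matrix.conjTranspose_conjTranspose, Matrix.conjTranspose_one]
    rwa [e, Matrix.frobenius_norm_conjTranspose, Matrix.frobenius_norm_conjTranspose, opNorm_sub_one_eq_opDist1] at h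
  rw [hsplit]
  refine (norm_add_le _ _).trans ?_
  linarith

end Unitary

/-! ## §3 The two norms compare: `‖A‖_op ≤ ‖A‖_HS ≤ √|n|·‖A‖_op` ([B7] (20) p. 21, 2nd and 3rd inequalities; kernel home `MatrixNorms`) -/

section Compare

/-- **`‖A‖_op ≤ ‖A‖_HS`** (Cauchy–Schwarz row by row: `‖Av‖₂² = Σ_i |Σ_k A_{ik}v_k|² ≤ Σ_i (Σ_k |A_{ik}|²)·‖v‖₂²`; [B7] (20) p. 21 «`‖X‖ ≤ |X|`»·√N;
= `MatrixNorms.opNorm_sq_le_sum_norm_sq` in the Frobenius instance). [folklore] -/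
theorem opNorm_le_frobenius_norm (A : Matrix n n ℂ) : ‖Matrix.toEuclideanCLM (n := n) (𝕜 := ℂ) A‖ ≤ ‖A‖ := by
  refine ContinuousLinearMap.opNorm_le_bound _ (norm_nonneg _) fun v => ?_
  have hsq : ‖Matrix.toEuclideanCLM (n := n) (𝕜 := ℂ) A v‖ ^ 2 ≤ (‖A‖ * ‖v‖) ^ 2 := by
    rw [EuclideanSpace.norm_sq_eq, mul_pow, frob_norm_sq, EuclideanSpace.norm_sq_eq, Finset.sum_mul]
    refine Finset.sum_le_sum fun i _ => ?_
    -- row `i`: `‖(Av)_i‖ ≤ Σ_k ‖A_{ik}‖‖v_k‖ ≤ …` by Cauchy–Schwarz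
    have hrow : ‖(Matrix.toEuclideanCLM (n := n) (𝕜 := ℂ) A v) i‖ ≤ ∑ k, ‖A i k‖ * ‖v k‖ := by
      have e : (Matrix.toEuclideanCLM (n := n) (𝕜 := ℂ) A v) i = ∑ k, A i k * v k := by
        rw [Matrix.ofLp_toEuclideanCLM]
        simp only [Matrix.mulVec, dotProduct]
      rw [e]
      refine (norm_sum_le _ _).trans (le_of_eq ?_)
      simp only [norm_mul]
    have hcs := Finset.sum_mul_sq_le_sq_mul_sq Finset.univ (fun k => ‖A i k‖) (fun k => ‖v k‖)
    have hnn : 0 ≤ ∑ k, ‖A i k‖ * ‖v k‖ := Finset.sum_nonneg fun k _ => mul_nonneg (norm_nonneg _) (norm_nonneg _)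
    calc ‖(Matrix.toEuclideanCLM (n := n) (𝕜 := ℂ) A v) i‖ ^ 2 ≤ (∑ k, ‖A i k‖ * ‖v k‖) ^ 2 :=
          pow_le_pow_left₀ (norm_nonneg _) hrow 2
      _ ≤ (∑ k, ‖A i k‖ ^ 2) * ∑ k, ‖v k‖ ^ 2 := hcs
  exact le_of_pow_le_pow_left₀ two_ne_zero (by positivity) hsq

/-- **`‖A‖²_HS ≤ |n|·‖A‖²_op`** (column by column: `Σ_i |A_{ij}|² = ‖A e_j‖₂² ≤ ‖A‖²_op`; [B7] (20) p. 21 «`|X| ≤ √N‖X‖`» squared·N; = `MatrixNorms.nhsNormSq_le_opNorm_sq`·N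
in the Frobenius instance). [folklore] -/
theorem frobenius_norm_sq_le_card_mul_opNorm_sq (A : Matrix n n ℂ) :
    ‖A‖ ^ 2 ≤ Fintype.card n * ‖Matrix.toEuclideanCLM (n := n) (𝕜 := ℂ) A‖ ^ 2 := by
  set T := Matrix.toEuclideanCLM (n := n) (𝕜 := ℂ) A with hT
  -- the basis vectors have norm one
  have he : ∀ j, ‖(toLp 2 (Pi.single j (1 : ℂ)) : EuclideanSpace ℂ n)‖ ^ 2 = 1 := by
    intro j
    rw [EuclideanSpace.norm_sq_eq]
    simp only [Pi.single_apply, apply_ite norm, norm_one, norm_zero, ite_pow, one_pow,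
      zero_pow two_ne_zero, Finset.sum_ite_eq', Finset.mem_univ, if_true]
  -- column `j` of `A` is `A e_j`
  have hcol : ∀ j, ∑ i, ‖A i j‖ ^ 2 ≤ ‖T‖ ^ 2 := by
    intro j
    have e1 : ∑ i, ‖A i j‖ ^ 2 = ‖T (toLp 2 (Pi.single j (1 : ℂ)))‖ ^ 2 := by
      rw [EuclideanSpace.norm_sq_eq]
      refine Finset.sum_congr rfl fun i _ => ?_
      rw [hT, Matrix.toEuclideanCLM_toLp, PiLp.toLp_apply, Matrix.mulVec_single_one, Matrix.col_apply]
    rw [e1]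
    calc ‖T (toLp 2 (Pi.single j (1 : ℂ)))‖ ^ 2 ≤ (‖T‖ * ‖(toLp 2 (Pi.single j (1 : ℂ)) : EuclideanSpace ℂ n)‖) ^ 2 :=
          pow_le_pow_left₀ (norm_nonneg _) (T.le_opNorm _) 2
      _ = ‖T‖ ^ 2 := by rw [mul_pow, he j, mul_one]
  calc ‖A‖ ^ 2 = ∑ j, ∑ i, ‖A i j‖ ^ 2 := by rw [frob_norm_sq, Finset.sum_comm]
    _ ≤ ∑ _j : n, ‖T‖ ^ 2 := Finset.sum_le_sum fun j _ => hcol j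
    _ = Fintype.card n * ‖T‖ ^ 2 := by rw [Finset.sum_const, nsmul_eq_mul, Finset.card_univ]

end Compare

/-! ## §4 Toy: `n = Fin 1` -/

section Toy

/- For `1 × 1` matrices the two letters of §3 read `‖A‖²_HS ≤ 1·‖A‖²_op` and `‖A‖_op ≤ ‖A‖_HS`. -/
example (A : Matrix (Fin 1) (Fin 1) ℂ) :
    ‖A‖ ^ 2 ≤ 1 * ‖Matrix.toEuclideanCLM (n := Fin 1) (𝕜 := ℂ) A‖ ^ 2 ∧ ‖Matrix.toEuclideanCLM (n := Fin 1) (𝕜 := ℂ) A‖ ≤ ‖A‖ := by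
  refine ⟨?_, opNorm_le_frobenius_norm A⟩
  have h := frobenius_norm_sq_le_card_mul_opNorm_sq A
  simpa only [Fintype.card_fin, Nat.cast_one] using h

end Toy

end Summit.QuantumFields.BalabanUV.T4Continuum.NE7b.HilbertSchmidtCurrencyLetters

end
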